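import Summits.CriticalPhenomena.PercolationContinuityZ3.Theorems.PercNearOneGluingNoHeavyLowerTailSahiCombMixDispatch
import Summits.CriticalPhenomena.PercolationContinuityZ3.Theorems.PercNearOneGluingNoHeavyLowerTailSahiCombMixFourSingletons

/-!
# The comb (tensor-Bernstein) hierarchy for Sahi's `E_k`, XLIV: **COMB H-MIX(4)** — OR-ing a coordinate into any sub-family of FOUR hereditarily comb-positive
# increasing events preserves hereditary comb positivity; hitting families of four coordinate sets

Support file of the one-cut programme (crux `NoHeavyLowerTail`, stmt-CriticalPhenomena-4575; cell `prim-masterthm`, seat P3, gen 8; HIERARCHY.md §15(d),(i)).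
The two cell interfaces of `…SahiCombMixFour` are discharged (`combCanonThreeSlotCells_zero/one/two/three` in `…SahiCombMixDispatch` — 34 lifted certificate cells and the
plain cells; `combFourSingletonCells` in `…SahiCombMixFourSingletons` — the four singleton classes), so the conditional assembly becomes a theorem:
* **`combHereditary_orCoord_four`** — COMB H-MIX(4): for every finite cube, every quadruple `U` of increasing events ignoring `e` with `CombHereditary U`, and every
  `G`, the OR-ed family `(U_j ∪ [G j]{e ∈ ω})_j` is `CombHereditary` (every row of its ∩-closed family has nonnegative tensor-Bernstein coefficients, in particular is
  nonnegative under every product measure).  This is the comb-level `n = 4` case of `SahiCombHereditary.CombHereditaryMixture`; the law-level analogue H-MIX(4) is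
  gen 7's `SahiMixture.hereditaryMixture_four`, and both are SHARP in `n` (H-MIX(5) is false: `…SahiMixtureHereditaryCex5`).
* **`combHereditary_orFamily_four`**, `hereditaryAllOrders_orFamily_four`, `sahiE_hitting_four_nonneg` — hence the hitting family of ANY FOUR coordinate sets of any
  finite cube is comb-positive at every order; under every product measure all rows `E_m` (`m ≤ 4`) of its ∩-closed family are nonnegative; in particular
  `E_4(μ_p; hit S_0, hit S_1, hit S_2, hit S_3) ≥ 0` — a new unconditional class of increasing events for Sahi's `E_4 ≥ 0` beyond comonotone and cylinder
  families (cf. `SahiCombHereditary.combHereditary_orFamily_three` for three sets).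
HONEST FRAMING: Sahi's (M⁺-4) / `C_4` for general increasing events remain OPEN; this closes the sub-class generated from nothing by ≤ 4 hitting constraints. [this work]
-/

noncomputable section

open scoped Classical

namespace Summit.CriticalPhenomena.PercolationContinuityZ3.Theorems

open Finset Function
open Literature.Combinatorics.Sahi2008
open Literature.Probability.Percolation.DecisionTree (ind)
open SahiComb
open SahiCombDisjunct (orCoord)
open SahiCombHereditary (CombHereditary)

variable {ι : Type} [Fintype ι]

namespace SahiCombMix

/-- All four canonical three-slot cell interfaces hold. [this work] -/
theorem combCanonThreeSlotCells_all : ∀ k : Fin 4, CombCanonThreeSlotCells k := by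
  intro k
  fin_cases k
  · exact combCanonThreeSlotCells_zero
  · exact combCanonThreeSlotCells_one
  · exact combCanonThreeSlotCells_two
  · exact combCanonThreeSlotCells_three

/-- **COMB H-MIX(4).**  OR-ing the coordinate `e` into any sub-family `G` of four increasing events ignoring `e` whose ∩-closed family is comb-positive at every order
yields a family whose ∩-closed family is again comb-positive at every order. [this work] -/
theorem combHereditary_orCoord_four (U : Fin 4 → Set (Set ι)) (e : ι) (G : Fin 4 → Bool) (hUup : ∀ j, IsUpperSet (U j))
    (hUe : ∀ (j : Fin 4) (b : Bool), secAt e b (U j) = U j) (hU : CombHereditary U) : CombHereditary (orCoord U e G) :=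
  combHereditary_orCoord_four_of_cells combCanonThreeSlotCells_all combFourSingletonCells U e G hUup hUe hU

/-- **The hitting family of any four coordinate sets is comb-positive at every order.** [this work] -/
theorem combHereditary_orFamily_four (S : Fin 4 → Finset ι) : CombHereditary (fun i => {ω : Set ι | ∃ a ∈ S i, a ∈ ω}) :=
  combHereditary_orFamily_four_of_cells combCanonThreeSlotCells_all combFourSingletonCells S

/-- Under every product measure, the hitting family of any four coordinate sets is hereditarily all-orders positive: every row `E_m` of its ∩-closed family is
nonnegative. [this work] -/
theorem hereditaryAllOrders_orFamily_four (S : Fin 4 → Finset ι) (p : ι → unitInterval) :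
    SahiMixture.HereditaryAllOrders (bernoulliWeight p) (fun i => {ω : Set ι | ∃ a ∈ S i, a ∈ ω}) :=
  (combHereditary_orFamily_four S).hereditaryAllOrders p

/-- **`E_4 ≥ 0` for the hitting events of any four coordinate sets under any product measure.** [this work] -/
theorem sahiE_hitting_four_nonneg (S : Fin 4 → Finset ι) (p : ι → unitInterval) :
    0 ≤ sahiE (bernoulliWeight p) 4 (fun i => ind {ω : Set ι | ∃ a ∈ S i, a ∈ ω}) := by
  have h := hereditaryAllOrders_orFamily_four S p 4 (fun j => {j})
  refine le_of_le_of_eq h ?_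
  congr 1; funext j
  rw [Finset.set_biInter_singleton]

end SahiCombMix

end Summit.CriticalPhenomena.PercolationContinuityZ3.Theorems

end
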